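import Mathlib

/-!
# Class-aware Schur test (Gram-matrix bound for a bilinear form)

Crux stmt-Parity-13325 `LiouvilleMAD.LambdaLiouvilleLevel`, line `log-power-dispersion`,
stub `stub_classSchur` (the unfolded `ClassSchurInequality` of the line skeleton).

Statement: for finite `S T ⊆ ℕ`, weights `α β : ℕ → ℝ`, a kernel `f : ℕ → ℕ → ℝ` and `R : ℝ`
such that every row sum of absolute values of the Gram matrix
`G(m,m') = ∑_{k ∈ T} f(m,k) f(m',k)` over `S` is `≤ R`, one has
`(∑_{m ∈ S} ∑_{k ∈ T} α_m β_k f(m,k))² ≤ (∑_{k ∈ T} β_k²) · (∑_{m ∈ S} α_m²) · R`.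

Proof summary.
1. Rewrite the form as `∑_{k ∈ T} β_k · c_k` with `c_k = ∑_{m ∈ S} α_m f(m,k)` and apply the
   finite Cauchy–Schwarz inequality `Finset.sum_mul_sq_le_sq_mul_sq` in `k`.
2. Expand `∑_k c_k² = ∑_m ∑_{m'} α_m α_{m'} G(m,m')`.
3. Schur's test: `α_m α_{m'} G ≤ |α_m α_{m'}| |G| ≤ ((α_m² + α_{m'}²)/2) |G(m,m')|`; since
   `|G(m,m')| = |G(m',m)|`, the two halves are equal after swapping the summation order, so the
   quadratic form is `≤ ∑_m α_m² ∑_{m'} |G(m,m')| ≤ (∑_m α_m²) R` by the row-sum hypothesis.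
   The case `S = ∅` is `0 ≤ 0`, so no sign assumption on `R` is needed.
-/

namespace Summit.Parity.GeneralizedHardyLittlewood.Theorems.LambdaLiouvilleLevel.LogPowerDispersion

open Finset

/-- **Schur's test** for a real matrix `G` on a finite index set `S` whose absolute values are
symmetric: the quadratic form `∑_m ∑_{m'} α_m α_{m'} G(m,m')` is at most `‖α‖² · R` whenever
every row sum `∑_{m'} |G(m,m')|` is `≤ R`. [folklore] [cite: IwaniecKowalski2004, §7.1] -/
theorem quadForm_le_sq_mul_rowSum (S : Finset ℕ) (α : ℕ → ℝ) (G : ℕ → ℕ → ℝ) (R : ℝ)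
    (hsym : ∀ m ∈ S, ∀ m' ∈ S, |G m' m| = |G m m'|)
    (hR : ∀ m ∈ S, ∑ m' ∈ S, |G m m'| ≤ R) :
    ∑ m ∈ S, ∑ m' ∈ S, α m * α m' * G m m' ≤ (∑ m ∈ S, α m ^ 2) * R := by
  -- pointwise bound `α_m α_{m'} G(m,m') ≤ (α_m²/2)|G(m,m')| + (α_{m'}²/2)|G(m',m)|`
  have hpt : ∀ m ∈ S, ∀ m' ∈ S,
      α m * α m' * G m m' ≤ α m ^ 2 / 2 * |G m m'| + α m' ^ 2 / 2 * |G m' m| := by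
    intro m hm m' hm'
    rw [hsym m hm m' hm']
    have h1 : α m * α m' * G m m' ≤ |α m * α m'| * |G m m'| := by
      rw [← abs_mul]
      exact le_abs_self _
    have h2 : |α m * α m'| ≤ (α m ^ 2 + α m' ^ 2) / 2 := by
      rw [abs_mul]
      have h := two_mul_le_add_sq (|α m|) (|α m'|)
      rw [sq_abs, sq_abs] at h
      linarith
    calc α m * α m' * G m m' ≤ |α m * α m'| * |G m m'| := h1
      _ ≤ (α m ^ 2 + α m' ^ 2) / 2 * |G m m'| :=
          mul_le_mul_of_nonneg_right h2 (abs_nonneg _)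
      _ = α m ^ 2 / 2 * |G m m'| + α m' ^ 2 / 2 * |G m m'| := by ring
  -- the first half, summed
  have hA : ∑ m ∈ S, ∑ m' ∈ S, α m ^ 2 / 2 * |G m m'|
      = ∑ m ∈ S, α m ^ 2 / 2 * ∑ m' ∈ S, |G m m'| := by
    refine Finset.sum_congr rfl fun m _ => ?_
    rw [Finset.mul_sum]
  -- the second half, summed: swap the order of summation
  have hB : ∑ m ∈ S, ∑ m' ∈ S, α m' ^ 2 / 2 * |G m' m|
      = ∑ m ∈ S, α m ^ 2 / 2 * ∑ m' ∈ S, |G m m'| := by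
    rw [Finset.sum_comm]
    refine Finset.sum_congr rfl fun m _ => ?_
    rw [Finset.mul_sum]
  -- row sums
  have hrow : ∑ m ∈ S, α m ^ 2 / 2 * ∑ m' ∈ S, |G m m'| ≤ ∑ m ∈ S, α m ^ 2 / 2 * R := by
    refine Finset.sum_le_sum fun m hm => ?_
    exact mul_le_mul_of_nonneg_left (hR m hm) (by positivity)
  calc ∑ m ∈ S, ∑ m' ∈ S, α m * α m' * G m m'
      ≤ ∑ m ∈ S, ∑ m' ∈ S, (α m ^ 2 / 2 * |G m m'| + α m' ^ 2 / 2 * |G m' m|) :=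
        Finset.sum_le_sum fun m hm => Finset.sum_le_sum fun m' hm' => hpt m hm m' hm'
    _ = ∑ m ∈ S, ∑ m' ∈ S, α m ^ 2 / 2 * |G m m'|
          + ∑ m ∈ S, ∑ m' ∈ S, α m' ^ 2 / 2 * |G m' m| := by
        rw [← Finset.sum_add_distrib]
        refine Finset.sum_congr rfl fun m _ => ?_
        rw [Finset.sum_add_distrib]
    _ = 2 * ∑ m ∈ S, α m ^ 2 / 2 * ∑ m' ∈ S, |G m m'| := by rw [hA, hB]; ring
    _ ≤ 2 * ∑ m ∈ S, α m ^ 2 / 2 * R := by linarith [hrow]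
    _ = (∑ m ∈ S, α m ^ 2) * R := by
        rw [Finset.sum_mul, Finset.mul_sum]
        refine Finset.sum_congr rfl fun m _ => ?_
        ring

/-- Expansion of `∑_{k ∈ T} (∑_{m ∈ S} α_m f(m,k))²` as the quadratic form of the Gram matrix
`G(m,m') = ∑_{k ∈ T} f(m,k) f(m',k)`. [folklore] -/
theorem sum_sq_sum_eq_gramForm (S T : Finset ℕ) (α : ℕ → ℝ) (f : ℕ → ℕ → ℝ) :
    ∑ k ∈ T, (∑ m ∈ S, α m * f m k) ^ 2
      = ∑ m ∈ S, ∑ m' ∈ S, α m * α m' * ∑ k ∈ T, f m k * f m' k := by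
  calc ∑ k ∈ T, (∑ m ∈ S, α m * f m k) ^ 2
      = ∑ k ∈ T, ∑ m ∈ S, ∑ m' ∈ S, α m * f m k * (α m' * f m' k) := by
        refine Finset.sum_congr rfl fun k _ => ?_
        rw [sq, Finset.sum_mul_sum]
    _ = ∑ m ∈ S, ∑ k ∈ T, ∑ m' ∈ S, α m * f m k * (α m' * f m' k) := Finset.sum_comm
    _ = ∑ m ∈ S, ∑ m' ∈ S, ∑ k ∈ T, α m * f m k * (α m' * f m' k) := by
        refine Finset.sum_congr rfl fun m _ => ?_
        exact Finset.sum_comm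
    _ = ∑ m ∈ S, ∑ m' ∈ S, α m * α m' * ∑ k ∈ T, f m k * f m' k := by
        refine Finset.sum_congr rfl fun m _ => Finset.sum_congr rfl fun m' _ => ?_
        rw [Finset.mul_sum]
        refine Finset.sum_congr rfl fun k _ => ?_
        ring

/-- **Class-aware Schur test** (the unfolded `ClassSchurInequality` of the line skeleton):
Cauchy–Schwarz over `k ∈ T`, then `⟨α, G α⟩ ≤ ‖α‖² · (max row sum of |G|)` by the symmetry
`|G(m,m')| = |G(m',m)|` of the Gram matrix `G(m,m') = ∑_{k ∈ T} f(m,k) f(m',k)` and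
`2|α_m α_{m'}| ≤ α_m² + α_{m'}²`.  The bound sees only the class box `S × T`.
[folklore] [cite: IwaniecKowalski2004, §7.1] -/
theorem classSchurInequality :
    ∀ (S T : Finset ℕ) (α β : ℕ → ℝ) (f : ℕ → ℕ → ℝ) (R : ℝ),
      (∀ m ∈ S, ∑ m' ∈ S, |∑ k ∈ T, f m k * f m' k| ≤ R) →
        (∑ m ∈ S, ∑ k ∈ T, α m * β k * f m k) ^ 2
          ≤ (∑ k ∈ T, β k ^ 2) * (∑ m ∈ S, α m ^ 2) * R := by
  intro S T α β f R hR
  -- Step 1: regroup the bilinear form as `∑_k β_k c_k`.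
  have hform : ∑ m ∈ S, ∑ k ∈ T, α m * β k * f m k
      = ∑ k ∈ T, β k * ∑ m ∈ S, α m * f m k := by
    rw [Finset.sum_comm]
    refine Finset.sum_congr rfl fun k _ => ?_
    rw [Finset.mul_sum]
    refine Finset.sum_congr rfl fun m _ => ?_
    ring
  -- Cauchy–Schwarz in `k`.
  have hCS : (∑ k ∈ T, β k * ∑ m ∈ S, α m * f m k) ^ 2
      ≤ (∑ k ∈ T, β k ^ 2) * ∑ k ∈ T, (∑ m ∈ S, α m * f m k) ^ 2 :=
    Finset.sum_mul_sq_le_sq_mul_sq T β (fun k => ∑ m ∈ S, α m * f m k)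
  -- Steps 2–3: Gram expansion and Schur's test.
  have hsym : ∀ m ∈ S, ∀ m' ∈ S,
      |∑ k ∈ T, f m' k * f m k| = |∑ k ∈ T, f m k * f m' k| := by
    intro m _ m' _
    congr 1
    exact Finset.sum_congr rfl fun k _ => mul_comm _ _
  have hq : ∑ k ∈ T, (∑ m ∈ S, α m * f m k) ^ 2 ≤ (∑ m ∈ S, α m ^ 2) * R := by
    rw [sum_sq_sum_eq_gramForm]
    exact quadForm_le_sq_mul_rowSum S α (fun m m' => ∑ k ∈ T, f m k * f m' k) R hsym hR
  have hβ : 0 ≤ ∑ k ∈ T, β k ^ 2 := Finset.sum_nonneg fun k _ => sq_nonneg _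
  calc (∑ m ∈ S, ∑ k ∈ T, α m * β k * f m k) ^ 2
      = (∑ k ∈ T, β k * ∑ m ∈ S, α m * f m k) ^ 2 := by rw [hform]
    _ ≤ (∑ k ∈ T, β k ^ 2) * ∑ k ∈ T, (∑ m ∈ S, α m * f m k) ^ 2 := hCS
    _ ≤ (∑ k ∈ T, β k ^ 2) * ((∑ m ∈ S, α m ^ 2) * R) := mul_le_mul_of_nonneg_left hq hβ
    _ = (∑ k ∈ T, β k ^ 2) * (∑ m ∈ S, α m ^ 2) * R := by ring

end Summit.Parity.GeneralizedHardyLittlewood.Theorems.LambdaLiouvilleLevel.LogPowerDispersion
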